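/-
Width seat `ym-line-cbag-p1-w2` (prover-ym-line-cbag-p1-w2-g2-0; own items 22254/22893 closed), route `ColdBoxAllGroups`, helping crux
`BulkAllGroups` (stmt-QuantumFields-22255), line `dlr-chessboard-G` (lead `ym-line-cbag-p2`): per-colour bounds on the SHIFTED GLUED
Dirichlet field with a scaled datum, for an ARBITRARY scaling — vocabulary-free G-port of `…BulkDominatesColdBoxWGlueSdatBound` +
`…BulkDominatesColdBoxWUnitsShift` §1.
-/
import Summits.QuantumFields.YangMills.Theorems.WeakCouplingRatesBulkDominatesColdBoxWGlueSdatBound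
import Summits.QuantumFields.YangMills.Theorems.WeakCouplingRatesBulkDominatesColdBoxWUnitsShift

/-!
# Crux `BulkAllGroups` (stmt-QuantumFields-22255), stubs N2-cov-G / N2-mean-G: the shifted glued field of a scaled datum, per colour and
# for an arbitrary scaling `s • θ` (vocabulary-free G-port of `abs_glue_sdat_shift_le`, `dirBackground_sdat_eq`, `half_sum_sq_sdat_shift_eq`,
# `sum_sdat_shift_mul_eq`)

In the `SU(2)` line the exterior chart datum `ϑ_c` enters the Gaussian side through the SCALED datum `sdat β ϑ c = √(2β)•ϑ c` (gnomonic chart: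
`β·cost ≈ ½|circ(√(2β)v)|²`).  In the exponential chart of a general compact group the natural scaling is different (`β·cost ≈ ½‖circ(√β a)‖²`,
brick «CubicG»), and the lead's datum objects fix their own convention.  The estimates themselves only use linearity, so they are recorded here
ONCE for an arbitrary scalar `s` and a single colour (a scalar edge field `θ : edges → ℝ`), to be instantiated by the datum-objects file:

* `sCirc_glue_smul_mean` — the background circulation is linear in the scaling: `F̄[s•θ](p) = s·F̄[θ](p)`, `F̄[θ] = sCirc (glue θ (mean θ))`;
* **`abs_glue_smul_shift_le`** — link smallness of the shifted glued field (goodTD sandwich, step 1): if `|θ e| ≤ r` off the cold box, `θ = 0` on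
  the temporal forest, `|dirCirc_p t| ≤ R` and `|F̄[s•θ](p)| ≤ R'` for all plaquettes, then for every edge
  `|glue (s•θ) (mean (s•θ) + t) e| ≤ (12H²+2H+1)((R + R') + 4|s|r)` (the G-free linear Poincaré ladder with small exterior
  `abs_le_of_sCirc_le_of_exterior_le`);
* `half_sum_sq_smul_eq`, `sum_smul_mul_smul_eq` — `½Σ_c (s·F_c)² = (s²/2)·Σ_c F_c²` and `Σ_c (sF_c)(sG_c) = s²·Σ_c F_cG_c` over `Fin D` (the
  constant terms of the mean / covariance cores in the interface's units; `s² = 2β` in the `SU(2)` convention, `s² = β` for `√β`-scaling).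
No sorry; no definition; standard axioms.  NOT a claim about the mass gap: rung-level support (R2xi-G `XiPow`, RECORD label); the Yang–Mills mass
gap is NOT proved by any of this.
-/

set_option autoImplicit false

noncomputable section

open Finset
open Literature.Probability.LatticeModels Literature.MathematicalPhysics.QuantumLattice
open Literature.MathematicalPhysics.QuantumFieldTheory Literature.MathematicalPhysics.QuantumFieldTheory.AxialGauge
open Literature.MathematicalPhysics.QuantumFieldTheory.LatticeMaxwell
open Summit.QuantumFields.YangMills.Theorems.WeakCouplingRates

namespace Summit.QuantumFields.YangMills.Theorems.ColdBoxAllGroups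

variable {H : ℕ}

/-! ## Linearity of the background in the scaling -/

/-- **The background circulation of a scaled datum**: `sCirc (glue (s•θ) (mean (s•θ))) p = s · sCirc (glue θ (mean θ)) p`. [folklore] -/
theorem sCirc_glue_smul_mean (s : ℝ) (θ : Literature.MathematicalPhysics.QuantumLattice.ZdEdge 4 → ℝ) (p : Plaq 4) :
    sCirc (glue (pin := fun e => e ∉ dirFreeEdges H) dirCorner (2 * H + 3) (s • θ)
        (mean (fun e => e ∉ dirFreeEdges H) dirCorner (2 * H + 3) (s • θ))) p =
      s * sCirc (glue (pin := fun e => e ∉ dirFreeEdges H) dirCorner (2 * H + 3) θ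
        (mean (fun e => e ∉ dirFreeEdges H) dirCorner (2 * H + 3) θ)) p := by
  rw [mean_smul, ← sCirc_smul']
  congr 1
  funext e
  rw [glue_smul]; rfl

/-- The shifted glued field of a scaled datum, pointwise: `glue (s•θ) (mean (s•θ) + t) e = s·glue θ (mean θ) e + glue 0 t e`. [folklore] -/
theorem glue_smul_mean_add_apply (s : ℝ) (θ : Literature.MathematicalPhysics.QuantumLattice.ZdEdge 4 → ℝ) (t : DirFree H → ℝ)
    (e : Literature.MathematicalPhysics.QuantumLattice.ZdEdge 4) :
    glue (pin := fun e => e ∉ dirFreeEdges H) dirCorner (2 * H + 3) (s • θ)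
        (mean (fun e => e ∉ dirFreeEdges H) dirCorner (2 * H + 3) (s • θ) + t) e =
      s * glue (pin := fun e => e ∉ dirFreeEdges H) dirCorner (2 * H + 3) θ
          (mean (fun e => e ∉ dirFreeEdges H) dirCorner (2 * H + 3) θ) e +
        glue (pin := fun e => e ∉ dirFreeEdges H) dirCorner (2 * H + 3) 0 t e := by
  rw [mean_smul]
  unfold LatticeMaxwell.glue
  split_ifs <;> simp

/-! ## Link smallness of the shifted glued field (per colour, arbitrary scaling) -/

/-- **Link smallness of the shifted glued field, per colour and for an arbitrary scaling** (G-port of `abs_glue_sdat_shift_le`).  Let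
`θ : edges → ℝ` satisfy `|θ e| ≤ r` off the cold box `Λ = boxEdges 4 (2H+1)` and vanish on the temporal forest; let `t` have plaquette circulations
`|dirCirc_p t| ≤ R` and let the background of the scaled datum satisfy `|sCirc (glue (s•θ) (mean (s•θ))) p| ≤ R'` for all plaquettes
(`r, R, R' ≥ 0`, `H ≥ 1`).  Then every value of the shifted glued field is small:
`|glue (s•θ) (mean (s•θ) + t) e| ≤ (12H²+2H+1)·((R + R') + 4·(|s|·r))`. -/
theorem abs_glue_smul_shift_le (hH : 1 ≤ H) (s : ℝ) {θ : Literature.MathematicalPhysics.QuantumLattice.ZdEdge 4 → ℝ} {r R R' : ℝ}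
    (hr : 0 ≤ r) (hR : 0 ≤ R) (hR' : 0 ≤ R')
    (hθ : ∀ e, e ∉ boxEdges 4 (2 * H + 1) → |θ e| ≤ r)
    (hforest : ∀ x : Site 4, (∀ k : Fin 4, 1 ≤ x k ∧ x k + 1 ≤ 2 * (H : ℤ)) → θ (x, 0) = 0)
    {t : EuclideanSpace ℝ (DirFree H)}
    (ht : ∀ p : ZdPlaquette 4, |dirCirc H (p.1, p.2.1.1, p.2.1.2) t| ≤ R)
    (hF : ∀ p : ZdPlaquette 4, |sCirc (glue (pin := fun e => e ∉ dirFreeEdges H) dirCorner (2 * H + 3) (s • θ)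
        (mean (fun e => e ∉ dirFreeEdges H) dirCorner (2 * H + 3) (s • θ))) (p.1, p.2.1.1, p.2.1.2)| ≤ R')
    (e : Literature.MathematicalPhysics.QuantumLattice.ZdEdge 4) :
    |glue (pin := fun e => e ∉ dirFreeEdges H) dirCorner (2 * H + 3) (s • θ)
        (mean (fun e => e ∉ dirFreeEdges H) dirCorner (2 * H + 3) (s • θ) + WithLp.ofLp t) e| ≤
      (12 * (H : ℝ) ^ 2 + 2 * H + 1) * ((R + R') + 4 * (|s| * r)) := by
  have hsr : 0 ≤ |s| * r := mul_nonneg (abs_nonneg _) hr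
  refine abs_le_of_sCirc_le_of_exterior_le hH _ hsr ?_ ?_ ?_ e
  · -- exterior: `|s θ e| ≤ |s| r` on the collar, `0` off the enlarged box
    intro e' he'
    by_cases hE : e' ∈ boxEdgesAt dirCorner (2 * H + 3)
    · have hpin : e' ∉ dirFreeEdges H := fun h => he' (mem_dirFreeEdges.1 h).1
      rw [glue_apply_pin _ _ hE hpin, Pi.smul_apply, smul_eq_mul, abs_mul]
      exact mul_le_mul_of_nonneg_left (hθ e' he') (abs_nonneg _)
    · rw [glue_apply_of_not_mem _ _ hE, abs_zero]; exact hsr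
  · -- forest: pinned, `θ = 0` there
    intro x hx
    have hmem : ((x, (0 : Fin 4)) : Literature.MathematicalPhysics.QuantumLattice.ZdEdge 4) ∈ boxEdges 4 (2 * H + 1) := by
      rw [mem_boxEdges_iff]
      exact ⟨fun k => by have := hx k; constructor <;> push_cast <;> omega, by have := hx 0; push_cast; omega⟩
    have hE : ((x, (0 : Fin 4)) : Literature.MathematicalPhysics.QuantumLattice.ZdEdge 4) ∈ boxEdgesAt dirCorner (2 * H + 3) :=
      boxEdges_subset_boxEdgesAt_dirCorner H hmem
    have hpin : ((x, (0 : Fin 4)) : Literature.MathematicalPhysics.QuantumLattice.ZdEdge 4) ∉ dirFreeEdges H := fun h =>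
      (mem_dirFreeEdges.1 h).2 ⟨rfl, fun k => by have := hx k; exact ⟨this.1, by exact_mod_cast this.2⟩⟩
    rw [glue_apply_pin _ _ hE hpin, Pi.smul_apply, smul_eq_mul, hforest x hx, mul_zero]
  · -- circulations: `F'(p) + dirCirc_p(t)`
    have hRR : 0 ≤ R + R' := by linarith
    refine abs_sCirc_le_of_forall_zdPlaquette _ hRR fun p => ?_
    rw [sCirc_glue_add_ofLp]
    calc |sCirc (glue (pin := fun e => e ∉ dirFreeEdges H) dirCorner (2 * H + 3) (s • θ)
            (mean (fun e => e ∉ dirFreeEdges H) dirCorner (2 * H + 3) (s • θ))) (p.1, p.2.1.1, p.2.1.2) +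
            dirCirc H (p.1, p.2.1.1, p.2.1.2) t|
        ≤ |sCirc (glue (pin := fun e => e ∉ dirFreeEdges H) dirCorner (2 * H + 3) (s • θ)
            (mean (fun e => e ∉ dirFreeEdges H) dirCorner (2 * H + 3) (s • θ))) (p.1, p.2.1.1, p.2.1.2)| +
            |dirCirc H (p.1, p.2.1.1, p.2.1.2) t| := abs_add_le _ _
      _ ≤ R' + R := add_le_add (hF p) (ht p)
      _ = R + R' := add_comm _ _

/-- One component is bounded by the Euclidean size over `Fin D`: `|v c| ≤ r` if `Σ_c v_c² ≤ r²`, `r ≥ 0`. [folklore] -/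
theorem abs_apply_le_of_sum_sq_le' {D : ℕ} {v : Fin D → ℝ} {r : ℝ} (hr : 0 ≤ r) (hv : ∑ c, v c ^ 2 ≤ r ^ 2) (c : Fin D) : |v c| ≤ r := by
  have h1 : v c ^ 2 ≤ ∑ c', v c' ^ 2 := Finset.single_le_sum (f := fun c' => v c' ^ 2) (fun c' _ => sq_nonneg _) (Finset.mem_univ c)
  exact abs_le_of_sq_le_sq' (by linarith) hr |>.elim (fun h h' => abs_le.2 ⟨h, h'⟩)

/-! ## The constant terms in the interface's units -/

/-- `½Σ_c (s·F_c)² = (s²/2)·Σ_c F_c²`. [folklore] -/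
theorem half_sum_sq_smul_eq {D : ℕ} (s : ℝ) (F : Fin D → ℝ) :
    1 / 2 * ∑ c, (s * F c) ^ 2 = s ^ 2 / 2 * ∑ c, F c ^ 2 := by
  simp_rw [mul_pow]
  rw [← Finset.mul_sum]; ring

/-- `Σ_c (s·F_c)(s·G_c) = s²·Σ_c F_c G_c`. [folklore] -/
theorem sum_smul_mul_smul_eq {D : ℕ} (s : ℝ) (F G : Fin D → ℝ) :
    ∑ c, (s * F c) * (s * G c) = s ^ 2 * ∑ c, F c * G c := by
  rw [Finset.mul_sum]
  exact Finset.sum_congr rfl fun c _ => by ring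

/-- With the `√β`-scaling of the exponential chart: `½Σ_c (√β·F_c)² = (β/2)·Σ_c F_c²` (`β ≥ 0`). [folklore] -/
theorem half_sum_sq_sqrt_smul_eq {D : ℕ} {β : ℝ} (hβ : 0 ≤ β) (F : Fin D → ℝ) :
    1 / 2 * ∑ c, (Real.sqrt β * F c) ^ 2 = β / 2 * ∑ c, F c ^ 2 := by
  rw [half_sum_sq_smul_eq, Real.sq_sqrt hβ]

/-- With the `√β`-scaling: `Σ_c (√β·F_c)(√β·G_c) = β·Σ_c F_c G_c` (`β ≥ 0`). [folklore] -/
theorem sum_sqrt_smul_mul_eq {D : ℕ} {β : ℝ} (hβ : 0 ≤ β) (F G : Fin D → ℝ) :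
    ∑ c, (Real.sqrt β * F c) * (Real.sqrt β * G c) = β * ∑ c, F c * G c := by
  rw [sum_smul_mul_smul_eq, Real.sq_sqrt hβ]

end Summit.QuantumFields.YangMills.Theorems.ColdBoxAllGroups

end
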